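import Summits.PneNP.PneNP.Theorems.SymmetryBudgetNoHiddenOrderProgramSrcsD
import Summits.PneNP.PneNP.Theorems.SymmetryBudgetNoHiddenOrderCertifiedSchemeDefs

/-!
# `NoHiddenOrder` (stmt-PneNP-14781), (R2c) VI: the window canoniser program — levels and rank

Route `PneNP/SymmetryBudget`; continues `SymmetryBudgetNoHiddenOrderProgramSrcsD.lean`.  The RANK of a gate of `Gt m`: a mixed-radix number
of the four coordinates `tier` (root data < labels < output helpers < outputs), `ms` (the label's `measure`: a label reads only labels of
smaller measure), `blk` (the block inside a label: analysis `2k` < transition `2k + 1` < branch values `2F + 2` < outputs `2F + 3`) and `lvl`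
(the local level inside a block, from the per-shape level tables `ccLvl … vlLvl`), with the radices `MS`, `BL`, `LV`; and `rank_lt_of_lex`.
That sources have smaller rank is `…ProgramRank*.lean`.  Supports stmt-PneNP-14781.
-/

set_option linter.dupNamespace false -- `Summit.PneNP.PneNP.…` (D-0017 single-conjunct layout)

namespace Summit.PneNP.PneNP.Theorems

open Finset CGBits BranchSum Literature.Computability.Complexity Literature.Computability.Complexity.SymProg

namespace WCanon.R2c

variable {m : ℕ}

/-- Local level of a `CmpCount` shape (for the rank). [folklore] -/
def ccLvl : CCGate m → ℕ
  | .geA _ => 0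
  | .geB _ => 0
  | .ngeA _ => 1
  | .both _ => 1
  | .none _ => 1
  | .eqv _ => 2
  | .eq => 3
  | .ltw _ => 2
  | .lt => 3

/-- Local level of a `CmpTwice` shape. [folklore] -/
def ctLvl : CTGate m → ℕ
  | .ge2A _ => 0
  | .geB _ => 0
  | .nge2A _ => 1
  | .tww _ => 2
  | .tw => 3

/-- Local level of a refinement shape: round `r` occupies `[12r, 12r + 12)`, the value read-out follows all rounds. [folklore] -/
def riLvl : RIGate m → ℕ
  | .c r _ _ _ => 12 * r + 1
  | .cmp r _ _ _ g => 12 * r + 2 + ccLvl g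
  | .nmem _ => 0
  | .nlt r _ _ => 12 * r + 1
  | .pre r _ _ _ _ => 12 * r + 6
  | .allpre r _ _ _ => 12 * r + 7
  | .wit r _ _ _ => 12 * r + 8
  | .prof r _ _ => 12 * r + 9
  | .tie r _ _ => 12 * r + 10
  | .ltS r _ _ => 12 * r + 11
  | .eqS r _ _ => 12 * r + 12
  | .vc _ _ => 12 * wn m + 1
  | .vge _ _ => 12 * wn m + 2
  | .vnge _ _ => 12 * wn m + 3
  | .vinA _ _ => 12 * wn m + 4
  | .vnm _ => 0
  | .vval _ _ => 12 * wn m + 5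

/-- Local level of the signature comparison shape. [folklore] -/
def vsLvl : VSGate m → ℕ
  | .both _ _ _ => 0
  | .none _ _ _ => 0
  | .eqv _ _ _ => 1
  | .nb _ _ => 0
  | .lt _ _ _ => 2
  | .less _ _ => 3
  | .eqall _ _ => 3

/-- Local level of the candidates' comparison shape. [folklore] -/
def voLvl : VOGate m → ℕ
  | .both _ _ _ => 0
  | .none _ _ _ => 0
  | .eqv _ _ _ => 1
  | .nb _ _ => 0
  | .lt _ _ _ => 2
  | .less _ _ => 3
  | .eqall _ _ => 3

/-- Local level of the parts' comparison shape. [folklore] -/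
def vaLvl : VAGate m → ℕ
  | .both _ _ _ => 0
  | .none _ _ _ => 0
  | .eqv _ _ _ => 1
  | .nb _ _ => 0
  | .lt _ _ _ => 2
  | .less _ _ => 3
  | .eqall _ _ => 3

/-- Local level of the analysis shape (`T = wn m` reachability rounds occupy `13 … 14 + 2T`). [folklore] -/
def anLvl : AnGate m → ℕ
  | .oPr _ _ _ _ => 0
  | .oLt _ _ => 1
  | .oEq _ _ => 1
  | .swPr _ _ _ _ => 2
  | .swApr _ _ _ _ => 3
  | .swTw _ _ g => 4 + ctLvl g
  | .swNadj _ _ => 0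
  | .swNtw _ _ => 8
  | .swKept _ _ => 9
  | .swAdded _ _ => 9
  | .swSw' _ _ => 10
  | .swSw _ _ => 11
  | .rE _ _ => 12
  | .rMid i _ _ _ => 14 + 2 * i
  | .rR i _ _ => 13 + 2 * i
  | .mcCy _ _ => 2
  | .mcBig _ => 3
  | .mcCmp _ _ g => 4 + ccLvl g
  | .mcTieLT _ _ => 8
  | .mcBo _ _ => 9
  | .mcBetter _ _ => 10
  | .mcNobetter _ => 11
  | .mcSel _ => 12
  | .nmem _ => 0
  | .ncons _ => 0
  | .cov _ _ => 14 + 2 * wn m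
  | .all _ => 15 + 2 * wn m
  | .nall _ => 16 + 2 * wn m
  | .disc _ => 17 + 2 * wn m
  | .isAND => 18 + 2 * wn m
  | .nisAND => 19 + 2 * wn m
  | .big2 => 0
  | .nbig2 => 1
  | .isOR => 20 + 2 * wn m
  | .stop => 1
  | .frozen => 2
  | .nfrozen => 3
  | .cand _ => 13
  | .ncand _ => 14
  | .dom _ => 15
  | .ndom _ => 16
  | .go => 16
  | .ngo => 17
  | .andok => 14 + 2 * wn m
  | .nandok => 15 + 2 * wn m

/-- Local level of the transition shape (the refinement occupies `3 … 12T + 8`). [folklore] -/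
def trLvl : TrGate m → ℕ
  | .tieD _ _ => 0
  | .ltI _ _ => 1
  | .bothD _ _ => 0
  | .noneD _ _ => 0
  | .deqv _ _ => 1
  | .eqI _ _ => 2
  | .rv g => 3 + riLvl g
  | .takeAnd => 0
  | .ntakeAnd => 1
  | .takeOr => 0
  | .ntakeOr => 1
  | .newMem _ => 0
  | .m1 _ => 2
  | .m2 _ => 1
  | .mx _ => 3
  | .v1 _ _ => 12 * wn m + 9
  | .v2 _ _ => 2
  | .vx _ _ => 12 * wn m + 10
  | .c1 _ => 1
  | .cx _ => 2
  | .d1 => 0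
  | .d2 => 0
  | .d3 => 0
  | .dx => 1

/-- Local level of the value shape at an individualisation node (`OV = 12T + 7`). [folklore] -/
def orLvl : OrGate m → ℕ
  | .ltx _ _ _ => 0
  | .eqx _ _ _ => 0
  | .rv _ g => 1 + riLvl g
  | .bothc _ _ _ => 12 * wn m + 7
  | .nonec _ _ _ => 12 * wn m + 7
  | .xnc _ _ _ => 12 * wn m + 8
  | .eqc _ => 12 * wn m + 9
  | .kept _ => 12 * wn m + 10
  | .cmu _ _ _ _ => 12 * wn m + 7
  | .cm _ _ _ => 12 * wn m + 8
  | .lc _ _ _ _ => 12 * wn m + 9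
  | .liftC _ _ _ => 12 * wn m + 10
  | .vc g => 12 * wn m + 11 + voLvl g
  | .beat _ _ => 12 * wn m + 15
  | .nbeat _ _ => 12 * wn m + 16
  | .best _ => 12 * wn m + 17
  | .orOk => 12 * wn m + 11
  | .ob _ _ => 12 * wn m + 18
  | .orBit _ => 12 * wn m + 19

/-- Local level of the value shape at a section node. [folklore] -/
def andLvl : AndGate m → ℕ
  | .nreach _ _ => 0
  | .partAt _ _ => 1
  | .isPart _ => 2
  | .nisPart _ => 3
  | .imp _ => 4
  | .andOk => 5
  | .vc g => vaLvl g
  | .pg _ _ _ => 4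
  | .cntGe _ _ => 5
  | .ncntGe _ _ => 6
  | .cntIs _ _ => 7
  | .eqp _ _ => 4
  | .multGe _ _ => 5
  | .rowSrc _ _ _ => 8
  | .pcb _ _ _ _ _ => 9
  | .pCol _ _ => 10
  | .scp _ _ _ _ => 8
  | .sameCopy _ _ => 9
  | .nsame _ _ => 10
  | .pab _ _ _ _ _ _ => 9
  | .pOwn _ _ => 10
  | .swu _ _ _ _ => 0
  | .swcc _ _ => 1
  | .xcp _ _ _ _ => 11
  | .xc _ _ => 12
  | .pX _ _ => 13
  | .pAdj _ _ => 14

/-- Local level of the output gates of a value. [folklore] -/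
def vlLvl : VlGate m → ℕ
  | .ndead => 0
  | .decOK => 1
  | .a1 => 0
  | .a2 => 0
  | .okk => 1
  | .ok => 2
  | .b1 _ => 0
  | .b2 _ => 0
  | .bb _ => 1
  | .bit _ => 2

/-- Tier: root data `0`, label gates `1`, output helpers `2`, outputs `3`. [folklore] -/
def tier : Gt m → ℕ
  | .tt => 0
  | .ff => 0
  | .adjW _ _ => 0
  | .adjO _ _ => 0
  | .sig _ => 0
  | .root _ => 0
  | .an _ _ _ => 1
  | .tr _ _ _ => 1
  | .vor _ _ => 1
  | .vand _ _ => 1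
  | .vl _ _ => 1
  | .woc _ _ _ _ => 2
  | .out _ => 3

/-- The measure of the label of a gate (`0` off labels). [folklore] -/
def ms : Gt m → ℕ
  | .an L _ _ => (toLab L).measure
  | .tr L _ _ => (toLab L).measure
  | .vor L _ => (toLab L).measure
  | .vand L _ => (toLab L).measure
  | .vl L _ => (toLab L).measure
  | _ => 0

/-- The block of a gate inside its label. [folklore] -/
def blk : Gt m → ℕ
  | .an _ k _ => 2 * k
  | .tr _ k _ => 2 * k + 1
  | .vor _ _ => 2 * pF m + 2
  | .vand _ _ => 2 * pF m + 2
  | .vl _ _ => 2 * pF m + 3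
  | _ => 0

/-- The local level of a gate inside its block. [folklore] -/
def lvl : Gt m → ℕ
  | .tt => 0
  | .ff => 0
  | .adjW _ _ => 0
  | .adjO _ _ => 0
  | .sig g => 1 + vsLvl g
  | .root g => 5 + riLvl g
  | .an _ _ g => anLvl g
  | .tr _ _ g => trLvl g
  | .vor _ g => orLvl g
  | .vand _ g => andLvl g
  | .vl _ g => vlLvl g
  | .woc _ _ _ _ => 0
  | .out _ => 1

/-- Radix of the measure coordinate: measures are `≤ n(n+1) + n`. [folklore] -/
def MS (m : ℕ) : ℕ := wn m * (wn m + 1) + wn m + 1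

/-- Radix of the block coordinate. [folklore] -/
def BL (m : ℕ) : ℕ := 2 * pF m + 4

/-- Radix of the level coordinate. [folklore] -/
def LV (m : ℕ) : ℕ := 14 * wn m + 21

/-- **The rank of a gate**: the mixed-radix number of `(tier, ms, blk, lvl)`. [folklore] -/
def rank (l : Gt m) : ℕ := ((tier l * MS m + ms l) * BL m + blk l) * LV m + lvl l

/-- The mixed-radix number is monotone in the lexicographic order of the coordinates (bounds needed on the smaller side only). [folklore] -/
theorem rank_lt_of_lex {t' s' b' l' t s b l M B Lv : ℕ} (hs : s' < M) (hb : b' < B) (hl : l' < Lv)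
    (h : t' < t ∨ (t' = t ∧ (s' < s ∨ (s' = s ∧ (b' < b ∨ (b' = b ∧ l' < l)))))) :
    ((t' * M + s') * B + b') * Lv + l' < ((t * M + s) * B + b) * Lv + l := by
  have step : ∀ {p' p q' q R : ℕ}, q' < R → (p' < p ∨ (p' = p ∧ q' < q)) → p' * R + q' < p * R + q := by
    intro p' p q' q R hq h
    rcases h with h | ⟨rfl, h⟩
    · calc p' * R + q' < p' * R + R := by omega
        _ = (p' + 1) * R := by ring
        _ ≤ p * R := Nat.mul_le_mul_right _ h
        _ ≤ p * R + q := Nat.le_add_right _ _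
    · omega
  have lexstep : ∀ {p' p q' q R : ℕ} {rest : Prop}, q' < R → (p' < p ∨ (p' = p ∧ (q' < q ∨ (q' = q ∧ rest)))) →
      (p' * R + q' < p * R + q ∨ (p' * R + q' = p * R + q ∧ rest)) := by
    intro p' p q' q R rest hq h
    rcases h with h | ⟨hp, h⟩
    · exact Or.inl (step hq (Or.inl h))
    · rcases h with h | ⟨hq', h⟩
      · exact Or.inl (step hq (Or.inr ⟨hp, h⟩))
      · exact Or.inr ⟨by rw [hp, hq'], h⟩
  exact step hl (lexstep hb (lexstep (rest := b' < b ∨ (b' = b ∧ l' < l)) hs h))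

end WCanon.R2c

end Summit.PneNP.PneNP.Theorems
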